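import Literature.MathematicalPhysics.QuantumLattice.OverlapLocality
import Literature.MathematicalPhysics.QuantumLattice.ApproximateEigenvectorLemmas
import Literature.MathematicalPhysics.QuantumLattice.LatticeToriProofs
import Literature.MathematicalPhysics.QuantumLattice.WilsonHoppingAlgebra
import HarnessLib

/-!
# Commutators of the twisted shifts are controlled by plaquettes

Topic `Literature/MathematicalPhysics/QuantumLattice`; namespace
`Literature.MathematicalPhysics.QuantumLattice`.  For a unitary representation `ρ` and a gauge
field `U` on the periodic lattice `(ℤ/L)⁴`, the `U`-twisted forward shift `F_μ = linkHop ρ U μ`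
(`(F_μ w)(x) = ρ(U(x,μ)) w(x + μ̂)`, Neuberger's `T_μ`) and its adjoint
(`(F_μᴴ w)(x) = ρ(U(x − μ̂, μ))⁻¹ w(x − μ̂)`) have mixed commutators which act, site by site, by
`ρ(hol) − 1` for a plaquette holonomy `hol` (Neuberger's "main relation"
`‖[T_μ, T_ν]‖ = ‖1 − P_{μν}‖`, `P_{μν}` site-diagonal with plaquette entries):

* `eucNorm_twistedShift_comm_le` — generic: two twisted shifts `x ↦ ρ(u_i(x)) w(x + s_i)` have
  `‖[T₁,T₂] w‖ ≤ δ‖w‖` if `‖1 − ρ(u₁(x)u₂(x+s₁)u₁(x+s₂)⁻¹u₂(x)⁻¹)‖ ≤ δ` wherever `w(x+s₁+s₂) ≠ 0`;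
* `eucNorm_linkHop_comm_mulVec_le` (`[F_μ,F_ν]`, plaquette `U_{μν}(x)`, `w(x+μ̂+ν̂) ≠ 0`),
  `eucNorm_linkHop_comm_conjTranspose_mulVec_le` (`[F_μ,F_νᴴ]`, plaquette `U_{νμ}(y)`,
  `w(y+μ̂) ≠ 0`), `eucNorm_conjTranspose_linkHop_comm_mulVec_le` (`[F_μᴴ,F_νᴴ]`, plaquette
  `U_{μν}(z)`, `w(z) ≠ 0`) — conjugation invariance `‖1 − ρ(kgk⁻¹)‖ = ‖1 − ρ(g)‖` absorbs the
  base-point transport;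
* `linkHop_comm_bounds_of_plaquette` — LOCAL packaging: if every plaquette based within torus
  (`ℓ^∞`) distance `1` of a site set `T` has `‖1 − ρ(U_p)‖ ≤ δ`, the three commutator types are
  `δ`-small on every colour vector supported over `T`.

Norms: `eucNorm` on `site × colour → ℂ`, the `ℓ²` operator norm on colour matrices
(`Matrix.Norms.L2Operator`).  Valid on every torus `L ≥ 1` (also `L ≤ 2`: only unitarity and
the group law are used).

Reference: H. Neuberger, *Bounds on the Wilson Dirac operator*, Phys. Rev. D 61 (2000) 085015,
arXiv:hep-lat/9911004, §"Lower bound". [Neuberger2000Bounds]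
-/

noncomputable section

open Matrix Finset
open scoped Kronecker ComplexOrder Matrix.Norms.L2Operator
open Literature.Probability.LatticeModels (TorusSite)
open Literature.MathematicalPhysics.QuantumFieldTheory
open Literature.MathematicalPhysics.QuantumLattice.NeubergerBound (eucNorm_sq_eq_sum)

namespace Literature.MathematicalPhysics.QuantumLattice

section LinkHops

variable {L N : ℕ} {G : Type*} [Group G] (ρ : G →* Matrix (Fin N) (Fin N) ℂ)

variable [NeZero L]

/-- **Action of the twisted shift**: `(F_μ w)(x, a) = Σ_b ρ(U(x,μ))_{ab} w(x + μ̂, b)`.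
[folklore] -/
theorem linkHop_mulVec_apply (U : GaugeConfig 4 L G) (μ : Fin 4) (w : TorusSite 4 L × Fin N → ℂ)
    (x : TorusSite 4 L) (a : Fin N) :
    (linkHop ρ U μ *ᵥ w) (x, a) = (ρ (U (x, μ)) *ᵥ fun b => w (x + Pi.single μ 1, b)) a := by
  rw [mulVec, dotProduct, Fintype.sum_prod_type,
    Finset.sum_eq_single_of_mem (Site.shift x μ) (Finset.mem_univ _), mulVec, dotProduct]
  · refine Finset.sum_congr rfl fun b _ => ?_
    simp only [linkHop, of_apply, if_true, Site.shift]
  · intro y _ hy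
    simp only [linkHop, of_apply, if_neg hy, zero_mul, Finset.sum_const_zero]

/-- **Action of the adjoint twisted shift**:
`(F_μᴴ w)(x, a) = Σ_b ρ(U(x − μ̂, μ)⁻¹)_{ab} w(x − μ̂, b)` for unitary `ρ`. [folklore] -/
theorem conjTranspose_linkHop_mulVec_apply (hρ : ∀ g, ρ g ∈ Matrix.unitaryGroup (Fin N) ℂ)
    (U : GaugeConfig 4 L G) (μ : Fin 4) (w : TorusSite 4 L × Fin N → ℂ) (x : TorusSite 4 L)
    (a : Fin N) :
    ((linkHop ρ U μ)ᴴ *ᵥ w) (x, a) =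
      (ρ (U (x - Pi.single μ 1, μ))⁻¹ *ᵥ fun b => w (x - Pi.single μ 1, b)) a := by
  rw [mulVec, dotProduct, Fintype.sum_prod_type,
    Finset.sum_eq_single_of_mem (x - Pi.single μ 1) (Finset.mem_univ _), mulVec, dotProduct]
  · refine Finset.sum_congr rfl fun b _ => ?_
    simp only [conjTranspose_apply, linkHop, of_apply, eq_shift_iff, if_true,
      star_rep_apply ρ hρ]
  · intro y _ hy
    have : ¬ x = Site.shift y μ := by rw [eq_shift_iff]; exact fun h => hy h
    simp only [conjTranspose_apply, linkHop, of_apply, if_neg this, star_zero, zero_mul,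
      Finset.sum_const_zero]

omit [NeZero L] in
/-- **Generic twisted-shift commutator bound.**  For two twisted shifts
`(T_i w)(x) = ρ(u_i(x)) w(x + s_i)`, the commutator `[T₁, T₂] w` at `x` is the colour matrix
`ρ(u₁(x))ρ(u₂(x+s₁)) − ρ(u₂(x))ρ(u₁(x+s₂)) = (ρ(hol(x)) − 1)·(unitary)` applied to
`w(x + s₁ + s₂)`, with the holonomy `hol(x) = u₁(x) u₂(x+s₁) u₁(x+s₂)⁻¹ u₂(x)⁻¹`; hence
`‖[T₁, T₂] w‖ ≤ δ ‖w‖` as soon as `‖1 − ρ(hol(x))‖ ≤ δ` wherever `w(x + s₁ + s₂) ≠ 0`.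
[cite: Neuberger2000Bounds, §Lower bound] -/
theorem eucNorm_twistedShift_comm_le [NeZero L] (hρ : ∀ g, ρ g ∈ Matrix.unitaryGroup (Fin N) ℂ)
    (u₁ u₂ : TorusSite 4 L → G) (s₁ s₂ : TorusSite 4 L) {δ : ℝ} (hδ : 0 ≤ δ)
    (w : TorusSite 4 L × Fin N → ℂ)
    (hw : ∀ x : TorusSite 4 L, (∃ b, w (x + s₁ + s₂, b) ≠ 0) →
      ‖(1 : Matrix (Fin N) (Fin N) ℂ) - ρ (u₁ x * u₂ (x + s₁) * (u₁ (x + s₂))⁻¹ * (u₂ x)⁻¹)‖ ≤ δ) :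
    eucNorm (fun p : TorusSite 4 L × Fin N =>
        ((ρ (u₁ p.1) * ρ (u₂ (p.1 + s₁)) - ρ (u₂ p.1) * ρ (u₁ (p.1 + s₂))) *ᵥ
          fun b => w (p.1 + s₁ + s₂, b)) p.2) ≤ δ * eucNorm w := by
  have hblock : ∀ x : TorusSite 4 L,
      eucNorm ((ρ (u₁ x) * ρ (u₂ (x + s₁)) - ρ (u₂ x) * ρ (u₁ (x + s₂))) *ᵥ
        fun b => w (x + s₁ + s₂, b)) ≤ δ * eucNorm (fun b => w (x + s₁ + s₂, b)) := by
    intro x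
    by_cases hx : (fun b => w (x + s₁ + s₂, b)) = 0
    · rw [hx, mulVec_zero, eucNorm_zero, mul_zero]
    · have hne : ∃ b, w (x + s₁ + s₂, b) ≠ 0 := by
        obtain ⟨b, hb⟩ := Function.ne_iff.mp hx
        exact ⟨b, hb⟩
      have hfac : ρ (u₁ x) * ρ (u₂ (x + s₁)) - ρ (u₂ x) * ρ (u₁ (x + s₂)) =
          (ρ (u₁ x * u₂ (x + s₁) * (u₁ (x + s₂))⁻¹ * (u₂ x)⁻¹) - 1) * ρ (u₂ x * u₁ (x + s₂)) := by
        rw [sub_mul, one_mul, ← map_mul, ← map_mul, ← map_mul]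
        congr 2
        group
      have hunit : (ρ (u₂ x * u₁ (x + s₂)))ᴴ * ρ (u₂ x * u₁ (x + s₂)) = 1 :=
        Matrix.mem_unitaryGroup_iff'.mp (hρ _)
      rw [hfac, ← mulVec_mulVec]
      calc _ ≤ ‖ρ (u₁ x * u₂ (x + s₁) * (u₁ (x + s₂))⁻¹ * (u₂ x)⁻¹) - 1‖ *
            eucNorm (ρ (u₂ x * u₁ (x + s₂)) *ᵥ fun b => w (x + s₁ + s₂, b)) :=
            eucNorm_mulVec_le _ _
        _ = ‖(1 : Matrix (Fin N) (Fin N) ℂ) - ρ (u₁ x * u₂ (x + s₁) * (u₁ (x + s₂))⁻¹ * (u₂ x)⁻¹)‖ *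
            eucNorm (fun b => w (x + s₁ + s₂, b)) := by
            rw [norm_sub_rev, eucNorm_mulVec_of_conjTranspose_mul_self hunit]
        _ ≤ _ := mul_le_mul_of_nonneg_right (hw x hne) (eucNorm_nonneg _)
  have hsq : eucNorm (fun p : TorusSite 4 L × Fin N =>
      ((ρ (u₁ p.1) * ρ (u₂ (p.1 + s₁)) - ρ (u₂ p.1) * ρ (u₁ (p.1 + s₂))) *ᵥ
        fun b => w (p.1 + s₁ + s₂, b)) p.2) ^ 2 ≤ (δ * eucNorm w) ^ 2 := by
    rw [eucNorm_sq_eq_sum, Fintype.sum_prod_type, mul_pow, eucNorm_sq_eq_sum w,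
      Fintype.sum_prod_type,
      ← Equiv.sum_comp (Equiv.addRight (s₁ + s₂)) (fun x => ∑ a, ‖w (x, a)‖ ^ 2),
      Finset.mul_sum]
    refine Finset.sum_le_sum fun x _ => ?_
    have h2 := pow_le_pow_left₀ (eucNorm_nonneg _) (hblock x) 2
    rw [eucNorm_sq_eq_sum, mul_pow, eucNorm_sq_eq_sum] at h2
    simpa only [Equiv.coe_addRight, add_assoc] using h2
  exact (pow_le_pow_iff_left₀ (eucNorm_nonneg _) (mul_nonneg hδ (eucNorm_nonneg _))
    two_ne_zero).mp hsq

/-- **Conjugation invariance**: `‖1 − ρ(k g k⁻¹)‖ = ‖1 − ρ(g)‖` for unitary `ρ`. [folklore] -/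
theorem norm_one_sub_rep_conj (hρ : ∀ g, ρ g ∈ Matrix.unitaryGroup (Fin N) ℂ) (k g : G) :
    ‖(1 : Matrix (Fin N) (Fin N) ℂ) - ρ (k * g * k⁻¹)‖ =
      ‖(1 : Matrix (Fin N) (Fin N) ℂ) - ρ g‖ := by
  have h : (1 : Matrix (Fin N) (Fin N) ℂ) - ρ (k * g * k⁻¹) =
      ρ k * ((1 : Matrix _ _ ℂ) - ρ g) * ρ k⁻¹ := by
    rw [mul_sub, sub_mul, mul_one, ← map_mul, ← map_mul, ← map_mul, mul_inv_cancel, map_one]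
  rw [h, CStarRing.norm_mul_mem_unitary _ (hρ _), CStarRing.norm_mem_unitary_mul _ (hρ _)]

/-- **Type `[F_μ, F_ν]`**: the commutator of two forward twisted shifts is the generic
twisted-shift commutator with `u₁ = U(·,μ)`, `s₁ = μ̂`, `u₂ = U(·,ν)`, `s₂ = ν̂`. [folklore] -/
theorem linkHop_comm_linkHop_mulVec (U : GaugeConfig 4 L G) (μ ν : Fin 4)
    (w : TorusSite 4 L × Fin N → ℂ) :
    (linkHop ρ U μ * linkHop ρ U ν - linkHop ρ U ν * linkHop ρ U μ) *ᵥ w =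
      fun p : TorusSite 4 L × Fin N =>
        ((ρ (U (p.1, μ)) * ρ (U (p.1 + Pi.single μ 1, ν)) -
            ρ (U (p.1, ν)) * ρ (U (p.1 + Pi.single ν 1, μ))) *ᵥ
          fun b => w (p.1 + Pi.single μ 1 + Pi.single ν 1, b)) p.2 := by
  ext ⟨x, a⟩
  simp only [sub_mulVec, Pi.sub_apply, ← mulVec_mulVec, linkHop_mulVec_apply,
    add_right_comm x (Pi.single ν (1 : ZMod L)) (Pi.single μ 1)]

/-- **Type `[F_μ, F_νᴴ]`**: generic form with `u₁ = U(·,μ)`, `s₁ = μ̂`, `u₂ = U(· − ν̂, ν)⁻¹`,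
`s₂ = −ν̂`. [folklore] -/
theorem linkHop_comm_conjTranspose_linkHop_mulVec (hρ : ∀ g, ρ g ∈ Matrix.unitaryGroup (Fin N) ℂ)
    (U : GaugeConfig 4 L G) (μ ν : Fin 4) (w : TorusSite 4 L × Fin N → ℂ) :
    (linkHop ρ U μ * (linkHop ρ U ν)ᴴ - (linkHop ρ U ν)ᴴ * linkHop ρ U μ) *ᵥ w =
      fun p : TorusSite 4 L × Fin N =>
        ((ρ (U (p.1, μ)) * ρ (U (p.1 + Pi.single μ 1 - Pi.single ν 1, ν))⁻¹ -
            ρ (U (p.1 - Pi.single ν 1, ν))⁻¹ * ρ (U (p.1 + -Pi.single ν 1, μ))) *ᵥ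
          fun b => w (p.1 + Pi.single μ 1 + -Pi.single ν 1, b)) p.2 := by
  ext ⟨x, a⟩
  simp only [sub_mulVec, Pi.sub_apply, ← mulVec_mulVec, linkHop_mulVec_apply,
    conjTranspose_linkHop_mulVec_apply ρ hρ, ← sub_eq_add_neg, sub_add_eq_add_sub]

/-- **Type `[F_μᴴ, F_νᴴ]`**: generic form with `u₁ = U(· − μ̂, μ)⁻¹`, `s₁ = −μ̂`,
`u₂ = U(· − ν̂, ν)⁻¹`, `s₂ = −ν̂`. [folklore] -/
theorem conjTranspose_linkHop_comm_mulVec (hρ : ∀ g, ρ g ∈ Matrix.unitaryGroup (Fin N) ℂ)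
    (U : GaugeConfig 4 L G) (μ ν : Fin 4) (w : TorusSite 4 L × Fin N → ℂ) :
    ((linkHop ρ U μ)ᴴ * (linkHop ρ U ν)ᴴ - (linkHop ρ U ν)ᴴ * (linkHop ρ U μ)ᴴ) *ᵥ w =
      fun p : TorusSite 4 L × Fin N =>
        ((ρ (U (p.1 - Pi.single μ 1, μ))⁻¹ * ρ (U (p.1 + -Pi.single μ 1 - Pi.single ν 1, ν))⁻¹ -
            ρ (U (p.1 - Pi.single ν 1, ν))⁻¹ * ρ (U (p.1 + -Pi.single ν 1 - Pi.single μ 1, μ))⁻¹) *ᵥ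
          fun b => w (p.1 + -Pi.single μ 1 + -Pi.single ν 1, b)) p.2 := by
  ext ⟨x, a⟩
  simp only [sub_mulVec, Pi.sub_apply, ← mulVec_mulVec, conjTranspose_linkHop_mulVec_apply ρ hρ,
    ← sub_eq_add_neg, sub_right_comm x (Pi.single ν (1 : ZMod L)) (Pi.single μ 1)]

/-- **Bound for `[F_μ, F_ν]`** by the plaquettes `U_{μν}(x)` based at the sites `x` with
`w(x + μ̂ + ν̂) ≠ 0`. [cite: Neuberger2000Bounds, §Lower bound] -/
theorem eucNorm_linkHop_comm_mulVec_le (hρ : ∀ g, ρ g ∈ Matrix.unitaryGroup (Fin N) ℂ)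
    (U : GaugeConfig 4 L G) (μ ν : Fin 4) {δ : ℝ} (hδ : 0 ≤ δ) (w : TorusSite 4 L × Fin N → ℂ)
    (hw : ∀ x : TorusSite 4 L, (∃ b, w (x + Pi.single μ 1 + Pi.single ν 1, b) ≠ 0) →
      ‖(1 : Matrix (Fin N) (Fin N) ℂ) - ρ (plaquetteHolonomy U x μ ν)‖ ≤ δ) :
    eucNorm ((linkHop ρ U μ * linkHop ρ U ν - linkHop ρ U ν * linkHop ρ U μ) *ᵥ w) ≤
      δ * eucNorm w := by
  have hgen := eucNorm_twistedShift_comm_le ρ hρ (fun y => U (y, μ)) (fun y => U (y, ν))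
    (Pi.single μ 1) (Pi.single ν 1) hδ w ?_
  · beta_reduce at hgen
    rwa [← linkHop_comm_linkHop_mulVec ρ] at hgen
  intro x hx
  exact hw x hx

/-- **Bound for `[F_μ, F_νᴴ]`** by the plaquettes `U_{νμ}(y)` based at the sites `y` with
`w(y + μ̂) ≠ 0`. [cite: Neuberger2000Bounds, §Lower bound] -/
theorem eucNorm_linkHop_comm_conjTranspose_mulVec_le
    (hρ : ∀ g, ρ g ∈ Matrix.unitaryGroup (Fin N) ℂ) (U : GaugeConfig 4 L G) (μ ν : Fin 4)
    {δ : ℝ} (hδ : 0 ≤ δ) (w : TorusSite 4 L × Fin N → ℂ)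
    (hw : ∀ y : TorusSite 4 L, (∃ b, w (y + Pi.single μ 1, b) ≠ 0) →
      ‖(1 : Matrix (Fin N) (Fin N) ℂ) - ρ (plaquetteHolonomy U y ν μ)‖ ≤ δ) :
    eucNorm ((linkHop ρ U μ * (linkHop ρ U ν)ᴴ - (linkHop ρ U ν)ᴴ * linkHop ρ U μ) *ᵥ w) ≤
      δ * eucNorm w := by
  have hgen := eucNorm_twistedShift_comm_le ρ hρ (fun y => U (y, μ))
    (fun y => (U (y - Pi.single ν 1, ν))⁻¹) (Pi.single μ 1) (-Pi.single ν 1) hδ w ?_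
  · beta_reduce at hgen
    rwa [← linkHop_comm_conjTranspose_linkHop_mulVec ρ hρ] at hgen
  intro x hx
  beta_reduce at hx ⊢
  set y : TorusSite 4 L := x - Pi.single ν 1 with hy
  have h1 : x + Pi.single μ 1 + -Pi.single ν 1 = y + Pi.single μ 1 := by rw [hy]; abel
  have h2 : x + Pi.single μ 1 - Pi.single ν 1 = y + Pi.single μ 1 := by rw [hy]; abel
  have h3 : x + -Pi.single ν 1 = y := by rw [hy]; abel
  have h4 : x = y + Pi.single ν 1 := by rw [hy]; abel
  rw [h1] at hx
  have key : U (x, μ) * (U (x + Pi.single μ 1 - Pi.single ν 1, ν))⁻¹ *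
      (U (x + -Pi.single ν 1, μ))⁻¹ * ((U (x - Pi.single ν 1, ν))⁻¹)⁻¹ =
        (U (y, ν))⁻¹ * plaquetteHolonomy U y ν μ * ((U (y, ν))⁻¹)⁻¹ := by
    rw [h2, h3, ← hy, plaquetteHolonomy, Site.shift, Site.shift, ← h4]
    group
  rw [key, norm_one_sub_rep_conj ρ hρ]
  exact hw y hx

/-- **Bound for `[F_μᴴ, F_νᴴ]`** by the plaquettes `U_{μν}(z)` based at the sites `z` with
`w(z) ≠ 0`. [cite: Neuberger2000Bounds, §Lower bound] -/
theorem eucNorm_conjTranspose_linkHop_comm_mulVec_le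
    (hρ : ∀ g, ρ g ∈ Matrix.unitaryGroup (Fin N) ℂ) (U : GaugeConfig 4 L G) (μ ν : Fin 4)
    {δ : ℝ} (hδ : 0 ≤ δ) (w : TorusSite 4 L × Fin N → ℂ)
    (hw : ∀ z : TorusSite 4 L, (∃ b, w (z, b) ≠ 0) →
      ‖(1 : Matrix (Fin N) (Fin N) ℂ) - ρ (plaquetteHolonomy U z μ ν)‖ ≤ δ) :
    eucNorm (((linkHop ρ U μ)ᴴ * (linkHop ρ U ν)ᴴ - (linkHop ρ U ν)ᴴ * (linkHop ρ U μ)ᴴ) *ᵥ w) ≤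
      δ * eucNorm w := by
  have hgen := eucNorm_twistedShift_comm_le ρ hρ (fun y => (U (y - Pi.single μ 1, μ))⁻¹)
    (fun y => (U (y - Pi.single ν 1, ν))⁻¹) (-Pi.single μ 1) (-Pi.single ν 1) hδ w ?_
  · beta_reduce at hgen
    rwa [← conjTranspose_linkHop_comm_mulVec ρ hρ] at hgen
  intro x hx
  beta_reduce at hx ⊢
  set z : TorusSite 4 L := x - Pi.single μ 1 - Pi.single ν 1 with hz
  have h1 : x + -Pi.single μ 1 + -Pi.single ν 1 = z := by rw [hz]; abel
  have h2 : x + -Pi.single μ 1 - Pi.single ν 1 = z := by rw [hz]; abel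
  have h3 : x + -Pi.single ν 1 - Pi.single μ 1 = z := by rw [hz]; abel
  have h4 : x - Pi.single μ 1 = z + Pi.single ν 1 := by rw [hz]; abel
  have h5 : x - Pi.single ν 1 = z + Pi.single μ 1 := by rw [hz]; abel
  rw [h1] at hx
  have key : (U (x - Pi.single μ 1, μ))⁻¹ * (U (x + -Pi.single μ 1 - Pi.single ν 1, ν))⁻¹ *
      ((U (x + -Pi.single ν 1 - Pi.single μ 1, μ))⁻¹)⁻¹ * ((U (x - Pi.single ν 1, ν))⁻¹)⁻¹ =
        ((U (z + Pi.single ν 1, μ))⁻¹ * (U (z, ν))⁻¹) * plaquetteHolonomy U z μ ν *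
          ((U (z + Pi.single ν 1, μ))⁻¹ * (U (z, ν))⁻¹)⁻¹ := by
    rw [h2, h3, h4, h5, plaquetteHolonomy, Site.shift, Site.shift]
    group
  rw [key, norm_one_sub_rep_conj ρ hρ]
  exact hw z hx

/-- `‖μ̂ + ν̂‖_∞ ≤ 1` on the periodic lattice for `μ ≠ ν`. [folklore] -/
theorem torusDist_add_single_add_single_le_one {μ ν : Fin 4} (hμν : μ ≠ ν) (y : TorusSite 4 L) :
    torusDist (y + Pi.single μ 1 + Pi.single ν 1) y ≤ 1 := by
  unfold torusDist
  rw [show y + Pi.single μ 1 + Pi.single ν 1 - y = Pi.single μ (1 : ZMod L) + Pi.single ν 1 by abel]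
  simp only [torusNorm]
  refine Finset.sup_le fun i _ => ?_
  simp only [Pi.add_apply, Pi.single_apply]
  by_cases hi : i = μ
  · subst hi
    rw [if_pos rfl, if_neg hμν, add_zero]
    exact cyclicAbs_one_le
  · by_cases hi' : i = ν
    · rw [if_neg hi, if_pos hi', zero_add]
      exact cyclicAbs_one_le
    · rw [if_neg hi, if_neg hi', add_zero, ZMod.val_zero]
      exact (min_le_left _ _).trans zero_le_one

/-- `‖μ̂‖_∞ ≤ 1` on the periodic lattice. [folklore] -/
theorem torusDist_add_single_le_one (y : TorusSite 4 L) (μ : Fin 4) :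
    torusDist (y + Pi.single μ 1) y ≤ 1 := by
  unfold torusDist
  rw [add_sub_cancel_left]
  simp only [torusNorm]
  refine Finset.sup_le fun i _ => ?_
  simp only [Pi.single_apply]
  by_cases hi : i = μ
  · rw [if_pos hi]; exact cyclicAbs_one_le
  · rw [if_neg hi, ZMod.val_zero]; exact (min_le_left _ _).trans zero_le_one

/-- **The three commutator bounds from a local plaquette hypothesis.**  If every plaquette
based within torus distance `1` of the site set `T` satisfies `‖1 − ρ(U_p)‖ ≤ δ`, then for every
colour vector `w` supported over `T` and all `μ ≠ ν` the commutators `[F_μ, F_ν]`,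
`[F_μ, F_νᴴ]`, `[F_μᴴ, F_νᴴ]` are `δ`-small on `w`. [cite: Neuberger2000Bounds, §Lower bound] -/
theorem linkHop_comm_bounds_of_plaquette (hρ : ∀ g, ρ g ∈ Matrix.unitaryGroup (Fin N) ℂ)
    (U : GaugeConfig 4 L G) {T : TorusSite 4 L → Prop} {δ : ℝ} (hδ : 0 ≤ δ)
    (hT : ∀ y : TorusSite 4 L, (∃ x, T x ∧ torusDist x y ≤ 1) → ∀ μ ν : Fin 4, μ ≠ ν →
      ‖(1 : Matrix (Fin N) (Fin N) ℂ) - ρ (plaquetteHolonomy U y μ ν)‖ ≤ δ) :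
    ∀ w : TorusSite 4 L × Fin N → ℂ, (∀ p, w p ≠ 0 → T p.1) → ∀ μ ν : Fin 4, μ ≠ ν →
      eucNorm ((linkHop ρ U μ * linkHop ρ U ν - linkHop ρ U ν * linkHop ρ U μ) *ᵥ w) ≤
          δ * eucNorm w ∧
        eucNorm ((linkHop ρ U μ * (linkHop ρ U ν)ᴴ - (linkHop ρ U ν)ᴴ * linkHop ρ U μ) *ᵥ w) ≤
          δ * eucNorm w ∧
        eucNorm (((linkHop ρ U μ)ᴴ * (linkHop ρ U ν)ᴴ - (linkHop ρ U ν)ᴴ * (linkHop ρ U μ)ᴴ) *ᵥ w) ≤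
          δ * eucNorm w := by
  intro w hw μ ν hμν
  refine ⟨?_, ?_, ?_⟩
  · exact eucNorm_linkHop_comm_mulVec_le ρ hρ U μ ν hδ w fun x ⟨b, hb⟩ =>
      hT x ⟨_, hw _ hb, torusDist_add_single_add_single_le_one hμν x⟩ μ ν hμν
  · exact eucNorm_linkHop_comm_conjTranspose_mulVec_le ρ hρ U μ ν hδ w fun y ⟨b, hb⟩ =>
      hT y ⟨_, hw _ hb, torusDist_add_single_le_one y μ⟩ ν μ hμν.symm
  · exact eucNorm_conjTranspose_linkHop_comm_mulVec_le ρ hρ U μ ν hδ w fun z ⟨b, hb⟩ =>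
      hT z ⟨z, hw _ hb, by rw [torusDist_self]; exact zero_le_one⟩ μ ν hμν

end LinkHops

end Literature.MathematicalPhysics.QuantumLattice
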